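import Mathlib
import Summits.NavierStokesRegularity.NavierStokesRegularity.Theorems.EulerZoomLiouvillePowerGaugeEulerLiouvilleVorticitySupportLimits
import HarnessLib

/-!
# Conservation of the measure of the vorticity support along classical Euler flows — the `R → ∞` step
# (helper of the symmetry-free DSS stratum of the crux `EulerZoomLiouville.PowerGaugeEulerLiouville`,
# route №10, item stmt-NavierStokesRegularity-19832)

Helper file (theorems only; `--supports stmt-NavierStokesRegularity-19832`). Seat ns-typeII-p3 (cell
ns-regularity-ideate §B, D-0081). Sequel of `…VorticitySupportLimits.lean` (which proves `½∫χ_R 𝟙_{S(T)} − ½∫χ_R 𝟙_{S(0)} =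
∫₀ᵀ ½∫ Dχ_R[u(σ)] 𝟙_{S(σ)}`, `S(σ) = {x : curl u(σ) x ≠ 0}`, `integral_cutoff_indicator_sub_eq`): `|…| ≤ T C B N/(2R)` when `vol S(σ) ≤ N`, and `R → ∞` gives
**`vol S(T) = vol S(0)`** (`volume_vorticitySupport_eq_of_Icc`) and, after a time shift, the same on the
open ancient slab (`volume_vorticitySupport_eq_of_classical`): for a classical Euler flow on `(−∞,0) × ℝ³`
with bounded velocity and velocity gradient and vorticity support of finite measure on a compact time
interval `[s,t]`, `vol {curl u(t) ≠ 0} = vol {curl u(s) ≠ 0}` (Helmholtz: the vorticity support is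
transported by the volume-preserving flow — proved here WITHOUT flow maps).

WHAT THIS IS NOT: not NS, not the crux — a conservation law of classical Euler flows. [folklore]
-/

noncomputable section

-- the summit and its single problem share the name `NavierStokesRegularity` (D-0017 nested layout)
set_option linter.dupNamespace false

open Set Function Filter Topology MeasureTheory Metric
open scoped NNReal ENNReal InnerProductSpace RealInnerProductSpace

namespace Summit.NavierStokesRegularity.NavierStokesRegularity.Theorems.PowerGaugeEulerLiouville.VorticitySupport

open Literature.Analysis Literature.Analysis.FluidPDE

section Cons

variable {T : ℝ} {v : ℝ → (EuclideanSpace ℝ (Fin 3)) → (EuclideanSpace ℝ (Fin 3))}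
  {q : ℝ → (EuclideanSpace ℝ (Fin 3)) → ℝ}

/-! ## The bound at fixed `R` and the limit `R → ∞` -/

/-- `∫ 𝟙_S = vol S` (real-valued) for the vorticity support of a `C²` field. [folklore] -/
theorem integral_indicator_vorticitySupport {w : (EuclideanSpace ℝ (Fin 3)) → (EuclideanSpace ℝ (Fin 3))}
    (hw : ContDiff ℝ 2 w) :
    ∫ x, {y | curl w y ≠ 0}.indicator (fun _ => (1 : ℝ)) x = volume.real {y | curl w y ≠ 0} := by
  rw [integral_indicator_const (1 : ℝ) (isOpen_vorticitySupport hw).measurableSet, smul_eq_mul, mul_one]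

/-- **The flux bound**: `|½∫ Dχ_R[u] 𝟙_S| ≤ ½ (C/R) B vol S`. [folklore] -/
theorem abs_integral_fderiv_cutoff_indicator_le {w w₁ : (EuclideanSpace ℝ (Fin 3)) → (EuclideanSpace ℝ (Fin 3))}
    (hw : ContDiff ℝ 2 w) {B : ℝ} (hB : ∀ y, ‖w₁ y‖ ≤ B) {R C : ℝ}
    (hC : ∀ x : (EuclideanSpace ℝ (Fin 3)), ‖fderiv ℝ (cutoff R) x‖ ≤ C / R)
    (hfin : volume {y | curl w y ≠ 0} ≠ ⊤) :
    |∫ x, fderiv ℝ (cutoff R) x (w₁ x) * {y | curl w y ≠ 0}.indicator (fun _ => (1 : ℝ)) x| ≤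
      C / R * B * volume.real {y | curl w y ≠ 0} := by
  have hSm : MeasurableSet {y | curl w y ≠ 0} := (isOpen_vorticitySupport hw).measurableSet
  have hC0 : 0 ≤ C / R := (norm_nonneg _).trans (hC 0)
  have hB0 : 0 ≤ B := (norm_nonneg _).trans (hB 0)
  have hind : Integrable (fun x => {y | curl w y ≠ 0}.indicator (fun _ => (1 : ℝ)) x) :=
    (integrable_indicator_iff hSm).2 (integrableOn_const hfin)
  have hpt : ∀ x, ‖fderiv ℝ (cutoff R) x (w₁ x) * {y | curl w y ≠ 0}.indicator (fun _ => (1 : ℝ)) x‖ ≤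
      C / R * B * {y | curl w y ≠ 0}.indicator (fun _ => (1 : ℝ)) x := by
    intro x
    have h0 : 0 ≤ {y | curl w y ≠ 0}.indicator (fun _ => (1 : ℝ)) x :=
      Set.indicator_nonneg (fun _ _ => zero_le_one) x
    rw [norm_mul, Real.norm_of_nonneg h0]
    gcongr
    calc ‖fderiv ℝ (cutoff R) x (w₁ x)‖ ≤ ‖fderiv ℝ (cutoff R) x‖ * ‖w₁ x‖ := (fderiv ℝ (cutoff R) x).le_opNorm _
      _ ≤ C / R * B := by gcongr; exacts [hC x, hB x]
  have h1 := norm_integral_le_of_norm_le (hind.const_mul (C / R * B)) (Eventually.of_forall hpt)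
  rw [Real.norm_eq_abs, integral_const_mul, integral_indicator_const (1 : ℝ) hSm, smul_eq_mul, mul_one] at h1
  exact h1

/-- **Conservation of the measure of the vorticity support on `[0, T]`** for a classical Euler flow
with `‖u‖, ‖∇u‖ ≤ B` and `vol {curl u(σ) ≠ 0} ≤ N` on `[0, T]`. [folklore] -/
theorem volume_vorticitySupport_eq_of_Icc (hT : 0 < T) (hv : IsClassicalNSSolutionOn (Icc 0 T) 0 0 v q)
    {B : ℝ} (hB : ∀ σ ∈ Icc 0 T, ∀ y, ‖v σ y‖ ≤ B ∧ ‖fderiv ℝ (v σ) y‖ ≤ B)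
    {N : ℝ≥0} (hN : ∀ σ ∈ Icc 0 T, volume {y | curl (v σ) y ≠ 0} ≤ N) :
    volume {y | curl (v T) y ≠ 0} = volume {y | curl (v 0) y ≠ 0} := by
  obtain ⟨C, hC0, hC⟩ := exists_norm_fderiv_cutoff_le (E := (EuclideanSpace ℝ (Fin 3)))
  have hTm : T ∈ Icc 0 T := ⟨hT.le, le_rfl⟩
  have h0m : (0 : ℝ) ∈ Icc 0 T := ⟨le_rfl, hT.le⟩
  have hB0 : 0 ≤ B := (norm_nonneg _).trans (hB 0 h0m 0).1
  have hv2 : ∀ σ ∈ Icc 0 T, ContDiff ℝ 2 (v σ) := fun σ hσ => (hv.contDiff_velocity hσ).of_le (by norm_cast)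
  have hfin : ∀ σ ∈ Icc 0 T, volume {y | curl (v σ) y ≠ 0} ≠ ⊤ := fun σ hσ =>
    ne_top_of_le_ne_top ENNReal.coe_ne_top (hN σ hσ)
  have hreal : ∀ σ ∈ Icc 0 T, volume.real {y | curl (v σ) y ≠ 0} ≤ N := fun σ hσ => by
    have := (ENNReal.toReal_le_toReal (hfin σ hσ) ENNReal.coe_ne_top).2 (hN σ hσ)
    simpa [Measure.real] using this
  -- the bound at scale `R = n + 1`
  have hbd : ∀ n : ℕ, |2⁻¹ * (∫ x, cutoff ((n : ℝ) + 1) x * {y | curl (v T) y ≠ 0}.indicator (fun _ => (1 : ℝ)) x) -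
      2⁻¹ * (∫ x, cutoff ((n : ℝ) + 1) x * {y | curl (v 0) y ≠ 0}.indicator (fun _ => (1 : ℝ)) x)| ≤
      C / ((n : ℝ) + 1) * B * N * 2⁻¹ * T := by
    intro n
    have hR : (0 : ℝ) < (n : ℝ) + 1 := by positivity
    rw [integral_cutoff_indicator_sub_eq hT hv hB hR]
    have hinner : ∀ σ ∈ Ioo 0 T, ‖2⁻¹ * ∫ x, fderiv ℝ (cutoff ((n : ℝ) + 1)) x (v σ x) *
        {y | curl (v σ) y ≠ 0}.indicator (fun _ => (1 : ℝ)) x‖ ≤ C / ((n : ℝ) + 1) * B * N * 2⁻¹ := by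
      intro σ hσ
      have hσ' : σ ∈ Icc 0 T := Ioo_subset_Icc_self hσ
      rw [Real.norm_eq_abs, abs_mul, abs_of_pos (by norm_num : (0 : ℝ) < 2⁻¹)]
      have h := abs_integral_fderiv_cutoff_indicator_le (hv2 σ hσ') (fun y => (hB σ hσ' y).1)
        (hC _ hR) (hfin σ hσ')
      have hC' : 0 ≤ C / ((n : ℝ) + 1) * B := by positivity
      nlinarith [hreal σ hσ', mul_le_mul_of_nonneg_left (hreal σ hσ') hC']
    have h := norm_setIntegral_le_of_norm_le_const (μ := volume) (s := Ioo 0 T) (by simp) hinner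
    rw [Real.norm_eq_abs, Real.volume_real_Ioo_of_le hT.le, sub_zero] at h
    exact h
  -- the limits `R → ∞`
  have hindT : Integrable (fun x => {y | curl (v T) y ≠ 0}.indicator (fun _ => (1 : ℝ)) x) :=
    (integrable_indicator_iff (isOpen_vorticitySupport (hv2 T hTm)).measurableSet).2
      (integrableOn_const (hfin T hTm))
  have hind0 : Integrable (fun x => {y | curl (v 0) y ≠ 0}.indicator (fun _ => (1 : ℝ)) x) :=
    (integrable_indicator_iff (isOpen_vorticitySupport (hv2 0 h0m)).measurableSet).2
      (integrableOn_const (hfin 0 h0m))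
  have hlim : Tendsto (fun n : ℕ => 2⁻¹ * (∫ x, cutoff ((n : ℝ) + 1) x *
        {y | curl (v T) y ≠ 0}.indicator (fun _ => (1 : ℝ)) x) -
      2⁻¹ * (∫ x, cutoff ((n : ℝ) + 1) x * {y | curl (v 0) y ≠ 0}.indicator (fun _ => (1 : ℝ)) x)) atTop
      (𝓝 (2⁻¹ * (∫ x, {y | curl (v T) y ≠ 0}.indicator (fun _ => (1 : ℝ)) x) -
        2⁻¹ * (∫ x, {y | curl (v 0) y ≠ 0}.indicator (fun _ => (1 : ℝ)) x))) :=
    ((tendsto_integral_cutoff_mul hindT).const_mul _).sub ((tendsto_integral_cutoff_mul hind0).const_mul _)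
  have hbound : Tendsto (fun n : ℕ => C / ((n : ℝ) + 1) * B * N * 2⁻¹ * T) atTop (𝓝 0) := by
    have h1 : Tendsto (fun n : ℕ => C / ((n : ℝ) + 1)) atTop (𝓝 0) :=
      tendsto_const_nhds.div_atTop (tendsto_natCast_atTop_atTop.atTop_add tendsto_const_nhds)
    simpa using ((h1.mul_const B).mul_const (N : ℝ)).mul_const 2⁻¹ |>.mul_const T
  have hzero : Tendsto (fun n : ℕ => 2⁻¹ * (∫ x, cutoff ((n : ℝ) + 1) x *
        {y | curl (v T) y ≠ 0}.indicator (fun _ => (1 : ℝ)) x) -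
      2⁻¹ * (∫ x, cutoff ((n : ℝ) + 1) x * {y | curl (v 0) y ≠ 0}.indicator (fun _ => (1 : ℝ)) x)) atTop (𝓝 0) :=
    squeeze_zero_norm (fun n => by rw [Real.norm_eq_abs]; exact hbd n) hbound
  have heq := tendsto_nhds_unique hlim hzero
  rw [integral_indicator_vorticitySupport (hv2 T hTm), integral_indicator_vorticitySupport (hv2 0 h0m)] at heq
  have hreq : volume.real {y | curl (v T) y ≠ 0} = volume.real {y | curl (v 0) y ≠ 0} := by linarith
  exact (ENNReal.toReal_eq_toReal_iff' (hfin T hTm) (hfin 0 h0m)).1 hreq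

/-- **Conservation of the measure of the vorticity support along a classical Euler flow on `(−∞, 0)`**:
for `(u, p)` classical on the open slab and `s < t < 0` such that on `[s, t]` the velocity and its
gradient are bounded by `B` and `vol {curl u(τ) ≠ 0} ≤ N`, one has `vol {curl u(t) ≠ 0} = vol {curl u(s) ≠ 0}`
(Helmholtz). [folklore] -/
theorem volume_vorticitySupport_eq_of_classical
    {u : ℝ → (EuclideanSpace ℝ (Fin 3)) → (EuclideanSpace ℝ (Fin 3))} {p : ℝ → (EuclideanSpace ℝ (Fin 3)) → ℝ}
    (hns : IsClassicalNSSolutionOn (Iio 0) 0 0 u p) {s t : ℝ} (hst : s < t) (ht : t < 0)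
    {B : ℝ} (hB : ∀ τ ∈ Icc s t, ∀ y, ‖u τ y‖ ≤ B ∧ ‖fderiv ℝ (u τ) y‖ ≤ B)
    {N : ℝ≥0} (hN : ∀ τ ∈ Icc s t, volume {y | curl (u τ) y ≠ 0} ≤ N) :
    volume {y | curl (u t) y ≠ 0} = volume {y | curl (u s) y ≠ 0} := by
  set T : ℝ := t - s with hTdef
  have hT : 0 < T := sub_pos.2 hst
  have hsub : Icc 0 T ⊆ (fun σ : ℝ => σ + s) ⁻¹' Iio (0 : ℝ) := by
    intro σ hσ
    show σ + s < 0
    have := hσ.2; rw [hTdef] at this; linarith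
  have hmem : ∀ σ ∈ Icc 0 T, σ + s ∈ Icc s t := fun σ hσ =>
    ⟨by linarith [hσ.1], by have := hσ.2; rw [hTdef] at this; linarith⟩
  have hv : IsClassicalNSSolutionOn (Icc 0 T) 0 0 (fun σ => u (σ + s)) (fun σ => p (σ + s)) :=
    (hns.comp_add_right s).mono hsub (uniqueDiffOn_Icc hT)
  have h := volume_vorticitySupport_eq_of_Icc hT hv (fun σ hσ => hB (σ + s) (hmem σ hσ))
    (fun σ hσ => hN (σ + s) (hmem σ hσ))
  simp only [hTdef, sub_add_cancel, zero_add] at h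
  exact h

end Cons

end Summit.NavierStokesRegularity.NavierStokesRegularity.Theorems.PowerGaugeEulerLiouville.VorticitySupport

end
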